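import Summits.ResolutionOfSingularities.ResolutionOfSingularities.Theorems.FrobeniusClosingPatchingRelPerfectDepthSNCPointwise
import Literature.AlgebraicGeometry.Resolution.SncParameterExchange
import Literature.AlgebraicGeometry.Resolution.BlowupRingExceptionalFibre
import HarnessLib

/-!
# Crux `PatchingRelPerfect` (stmt-ResolutionOfSingularities-16161), chain W5.2 — T5-E brick (L-C):
# the SWAP / COMBINATION lemma for simple normal crossings AT A POINT (one parameter exchange)

[OURS · L1 W5.2 · TargetsF5 v4 (`…DepthMixedTargetsJ`), T5-E «W₂B-maxweight», brick (L-C) of res-D-pv-054 AS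
res-L1-w52-stub-6's RE-CUT 2026-08-27T07:50:48Z (ii) = res-L1-w52-plan-1's T5-K (k2)+(k3)] Replaces the role of NO
printed item; NOT a statement of the manuscript under review; fact-free, any dimension.

The E-side transport along a Cossart–Jannsen–Saito sequence must certify, at the required points `z` of each centre
`C`, the JOINT clause `JointStepAt` of F5 v4: ONE regular system of parameters of `𝒪_{E,z}` adapted simultaneously to
the HOST `𝓗` (`𝓗_z = (h)`, `h ∈ C_z`), to the tracked boundary members, and to the centre. The transport holds two
partial data: (1) from Cossart–Jannsen–Saito's «n.c.» clause (res-type-019's `hasSNCWith_of_isNormalCrossingWith`,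
p509976, read pointwise) a system adapted to ALL boundary members `ℬ` through `z` and to `C`; (2) the invariant (J#)
«host :: tracked members `𝒦`» snc at `z` (no centre). This file COMBINES them by the classical one-parameter
exchange (Kollár 2007, 3.104 Step 2.1; tree `Literature/…/SncParameterExchange.lean`: `rsop_not_mem_span_image_sup_sq`,
`exists_isUnit_coeff_of_not_mem`, `rsop_update`, whose global `HasSNCWith.cons_of_le` is the case `𝒦 = ℬ`, `𝓗 ≤ C`):
write `h = Σ_{i ∈ S} a_i u_i` in the system `u` of (1) (`C_z = (u_i : i ∈ S)`); by (2), `h` is independent modulo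
`𝔪_z²` of the equations of the members of `𝒦` through `z`, so some centre coordinate `u_{i₀}`, `i₀ ∈ S`, NOT
labelling a member of `𝒦`, has a unit coefficient; `u_{i₀} ↦ h` is again a regular system of parameters with the same
centre ideal, adapted to `𝓗`, to every member of `ℬ` through `z` whose label is `≠ i₀` — in particular to all of `𝒦`
and to every member TRANSVERSAL to the centre (`B_z ⊄ C_z`, label outside `S`) — and to `C`.

* `SNCWithAt.cons_of_stalkIdeal_le` — **MAIN**: `SNCWithAt ℬ C x`, `SNCWithAt (𝓗 :: 𝒦) ⊤ x` and `𝓗_x ≤ C_x`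
  give `SNCWithAt (𝓗 :: 𝒦') C x` for every list `𝒦'` whose members through `x` are members of `ℬ` that are in `𝒦`
  or transversal to `C` at `x` (no hypothesis relating `𝒦` to `ℬ` is needed: members of `𝒦` outside `ℬ` are simply
  not transferable);
* `SNCWithAt.cons_of_span_singleton_mem` — the same with the host read as «`𝓗_x = (h)`, `h ∈ C_x`»;
* `SNCWithAt.cons_transversal` — the COMBINATION case `𝒦' = 𝒦 ++ T`, `T` any list of `ℬ`-members transversal
  to `C` at `x`.

## References
* J. Kollár, *Lectures on Resolution of Singularities* (2007), 3.104 Step 2.1, Def. 3.24–3.25. [Kollar2007]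
* E. Bierstone, D. Grigoriev, P. Milman, J. Włodarczyk, arXiv:1206.3090, Def. 3.1.1, Def. 3.1.3 (2).
  [BierstoneGrigorievMilmanWlodarczyk2011]
* H. Matsumura, *Commutative Ring Theory* (1986), Thm. 14.2. [Matsumura1987]
-/

-- `Summit.<Summit>.<Sub>.Theorems` with `Sub = Summit` (single-conjunct summit, D-0017)
set_option linter.dupNamespace false

noncomputable section

open CategoryTheory CategoryTheory.Limits AlgebraicGeometry TopologicalSpace IsLocalRing
open Literature.AlgebraicGeometry.Resolution

namespace Summit.ResolutionOfSingularities.ResolutionOfSingularities.Theorems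

universe u

namespace DepthSNC

namespace SNCWithAt

variable {X : Scheme.{u}} {ℬ 𝒦 𝒦' : List X.IdealSheafData} {C 𝓗 : X.IdealSheafData} {x : X}

/-- [OURS · L1 W5.2 · T5-E (L-C)] **SWAP / COMBINATION at a point.** Let `ℬ` have simple normal crossings with
the centre `C` at `x` and let the host `𝓗` together with a list `𝒦` have simple normal crossings at `x` (no
centre); suppose `𝓗_x ⊆ C_x` (the host contains the centre near `x`). Then `𝓗 :: 𝒦'` has simple normal crossings
WITH `C` at `x` for every list `𝒦'` each of whose members through `x` is a member of `ℬ` that either belongs to `𝒦`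
or is transversal to the centre at `x` (`B_x ⊄ C_x`). One parameter exchange (Kollár 3.104 Step 2.1): the members of
`𝒦 ∩ ℬ` through `x` forbid their labels, the transversal ones have labels off the centre block, and a free centre
label with unit coefficient in `h` remains. [cite: Kollar2007, 3.104 Step 2.1] [cite: Matsumura1987, Thm. 14.2] -/
theorem cons_of_stalkIdeal_le (hℬ : SNCWithAt ℬ C x) (h𝓗 : SNCWithAt (𝓗 :: 𝒦) ⊤ x)
    (h𝓗C : stalkIdeal 𝓗 x ≤ stalkIdeal C x)
    (h𝒦' : ∀ B ∈ 𝒦', x ∈ B.support → B ∈ ℬ ∧ (B ∈ 𝒦 ∨ ¬ stalkIdeal B x ≤ stalkIdeal C x)) :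
    SNCWithAt (𝓗 :: 𝒦') C x := by
  classical
  by_cases hxC : x ∈ C.support
  swap
  · -- off the centre: every member of `𝒦'` through `x` is in `𝒦` (`C_x = ⊤`), and the centre clause is vacuous
    refine (h𝓗.anti fun D hD hxD => ?_).of_not_mem_support hxC
    rcases List.mem_cons.mp hD with h | h
    · exact h ▸ List.mem_cons_self
    · rcases (h𝒦' D h hxD).2 with h' | h'
      · exact List.mem_cons_of_mem _ h'
      · exact absurd (by rw [stalkIdeal_eq_top_of_not_mem_support hxC]; exact le_top) h'
  by_cases hx𝓗 : x ∈ 𝓗.support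
  swap
  · -- `x ∉ V(𝓗)` is impossible: `𝓗_x = ⊤ ⊆ C_x ⊆ 𝔪_x`
    exfalso
    have h1 : stalkIdeal C x = ⊤ :=
      top_le_iff.mp ((stalkIdeal_eq_top_of_not_mem_support hx𝓗).symm.le.trans h𝓗C)
    exact ((mem_support_iff_stalkIdeal_le C x).mp hxC |>.trans_lt
      (lt_top_iff_ne_top.mpr (maximalIdeal.isMaximal _).ne_top)).ne h1
  obtain ⟨hreg, d, u, hd, hu, ⟨ι, hι, hιD⟩, hCx⟩ := hℬ
  obtain ⟨S, hS⟩ := hCx hxC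
  haveI := hreg
  obtain ⟨-, d', v, hd', hv, ⟨ι', hι', hι'D⟩, -⟩ := h𝓗
  -- the member `𝓗` of `𝓗 :: 𝒦` through `x` and its equation `h`
  let Hm : {D // D ∈ 𝓗 :: 𝒦 ∧ x ∈ D.support} := ⟨𝓗, List.mem_cons_self, hx𝓗⟩
  set h : X.presheaf.stalk x := v (ι' Hm) with hh
  have hHx : stalkIdeal 𝓗 x = Ideal.span {h} := hι'D Hm
  -- `h ∈ C_x = (u_i : i ∈ S)`: `h = Σ_{i ∈ SF} l_i u_i` with `SF ⊆ S`
  have hhC : h ∈ Ideal.span (u '' S) := by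
    rw [← hS]
    exact h𝓗C (hHx ▸ Ideal.mem_span_singleton_self h)
  obtain ⟨l, hl, hlh⟩ := (Finsupp.mem_span_image_iff_linearCombination (R := X.presheaf.stalk x) (v := u)).mp hhC
  have hlS : (↑l.support : Set _) ⊆ S := (Finsupp.mem_supported (X.presheaf.stalk x) l).mp hl
  have hsum : ∑ i ∈ l.support, l i * u i = h := by
    rw [← hlh, Finsupp.linearCombination_apply, Finsupp.sum]
    rfl
  -- the members of `𝒦` through `x` other than `𝓗`, seen in `ℬ` and in `𝓗 :: 𝒦`
  let KS := {D : {D // D ∈ ℬ ∧ x ∈ D.support} // D.1 ∈ 𝒦 ∧ D.1 ≠ 𝓗}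
  let embℬ : KS → {D // D ∈ ℬ ∧ x ∈ D.support} := fun D => D.1
  let emb𝒦 : KS → {D // D ∈ 𝓗 :: 𝒦 ∧ x ∈ D.support} :=
    fun D => ⟨D.1.1, List.mem_cons_of_mem _ D.2.1, D.1.2.2⟩
  set T : Set (Fin d) := Set.range (fun D : KS => ι (embℬ D)) with hTdef
  -- their equations: `(u_{ι D}) = (v_{ι' D})`
  have hspan : Ideal.span (u '' T) = Ideal.span (v '' Set.range (fun D : KS => ι' (emb𝒦 D))) := by
    apply le_antisymm
    · rw [Ideal.span_le]
      rintro _ ⟨_, ⟨D, rfl⟩, rfl⟩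
      have h1 : u (ι (embℬ D)) ∈ stalkIdeal D.1.1 x :=
        (hιD (embℬ D)).symm ▸ Ideal.mem_span_singleton_self _
      rw [hι'D (emb𝒦 D)] at h1
      have hsub : ({v (ι' (emb𝒦 D))} : Set (X.presheaf.stalk x)) ⊆ v '' Set.range (fun D : KS => ι' (emb𝒦 D)) :=
        Set.singleton_subset_iff.mpr ⟨ι' (emb𝒦 D), ⟨D, rfl⟩, rfl⟩
      exact Ideal.span_mono hsub h1
    · rw [Ideal.span_le]
      rintro _ ⟨_, ⟨D, rfl⟩, rfl⟩
      have h1 : v (ι' (emb𝒦 D)) ∈ stalkIdeal D.1.1 x :=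
        (hι'D (emb𝒦 D)).symm ▸ Ideal.mem_span_singleton_self _
      rw [hιD (embℬ D)] at h1
      have hsub : ({u (ι (embℬ D))} : Set (X.presheaf.stalk x)) ⊆ u '' T :=
        Set.singleton_subset_iff.mpr ⟨ι (embℬ D), ⟨D, rfl⟩, rfl⟩
      exact Ideal.span_mono hsub h1
  -- `h` is independent of them modulo `𝔪²`
  have hfree : h ∉ Ideal.span (u '' T) ⊔ maximalIdeal (X.presheaf.stalk x) ^ 2 := by
    rw [hspan, hh]
    refine rsop_not_mem_span_image_sup_sq hd' v hv fun hmem => ?_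
    obtain ⟨D, hD⟩ := hmem
    have e : D.1.1 = 𝓗 := congrArg Subtype.val (hι' hD)
    exact D.2.2 e
  rw [← hsum] at hfree
  obtain ⟨i₀, hi₀, hi₀T, hunit⟩ := exists_isUnit_coeff_of_not_mem u hu l.support T l hfree
  have hi₀S : i₀ ∈ S := hlS hi₀
  -- exchange `u_{i₀}` for `h`
  obtain ⟨hw, hwS⟩ := rsop_update u hu l.support l hi₀ hunit
  rw [hsum] at hw hwS
  set w := Function.update u i₀ h with hwdef
  have hwi₀ : w i₀ = h := Function.update_self i₀ h u
  have hwne : ∀ {i}, i ≠ i₀ → w i = u i := fun hi => Function.update_of_ne hi h u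
  -- the members of `𝓗 :: 𝒦'` through `x` other than `𝓗` are members of `ℬ` with label `≠ i₀`
  have hmemℬ : ∀ D : {D // D ∈ 𝓗 :: 𝒦' ∧ x ∈ D.support}, D.1 ≠ 𝓗 → D.1 ∈ ℬ := fun D hD =>
    (h𝒦' D.1 ((List.mem_cons.mp D.2.1).resolve_left hD) D.2.2).1
  have hne : ∀ (D : {D // D ∈ 𝓗 :: 𝒦' ∧ x ∈ D.support}) (hD : D.1 ≠ 𝓗),
      ι ⟨D.1, hmemℬ D hD, D.2.2⟩ ≠ i₀ := by
    intro D hD e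
    have hD𝒦' : D.1 ∈ 𝒦' := (List.mem_cons.mp D.2.1).resolve_left hD
    rcases (h𝒦' D.1 hD𝒦' D.2.2).2 with h1 | h1
    · -- a member of `𝒦`: its label lies in `T ∌ i₀`
      exact hi₀T ⟨⟨⟨D.1, hmemℬ D hD, D.2.2⟩, h1, hD⟩, e⟩
    · -- a transversal member: its label lies outside `S ∋ i₀`
      apply h1
      rw [hιD ⟨D.1, hmemℬ D hD, D.2.2⟩, hS, e]
      exact Ideal.span_mono (Set.singleton_subset_iff.mpr ⟨i₀, hi₀S, rfl⟩)
  -- the new labelling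
  let ι'' : {D // D ∈ 𝓗 :: 𝒦' ∧ x ∈ D.support} → Fin d := fun D =>
    if hD : D.1 = 𝓗 then i₀ else ι ⟨D.1, hmemℬ D hD, D.2.2⟩
  refine ⟨hreg, d, w, hd, hw, ⟨ι'', ?_, ?_⟩, fun _ => ⟨S, ?_⟩⟩
  · -- injective
    intro D₁ D₂ heq
    by_cases h₁ : D₁.1 = 𝓗 <;> by_cases h₂ : D₂.1 = 𝓗
    · exact Subtype.ext (h₁.trans h₂.symm)
    · exfalso
      simp only [ι'', dif_pos h₁, dif_neg h₂] at heq
      exact hne D₂ h₂ heq.symm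
    · exfalso
      simp only [ι'', dif_neg h₁, dif_pos h₂] at heq
      exact hne D₁ h₁ heq
    · simp only [ι'', dif_neg h₁, dif_neg h₂] at heq
      have e := congrArg Subtype.val (hι heq)
      exact Subtype.ext e
  · -- the equations
    intro D
    by_cases hD : D.1 = 𝓗
    · simp only [ι'', dif_pos hD, hwi₀]
      rw [hD, hHx]
    · simp only [ι'', dif_neg hD]
      rw [hwne (hne D hD)]
      exact hιD ⟨D.1, hmemℬ D hD, D.2.2⟩
  · -- the centre: `(u_i : i ∈ S) = (w_i : i ∈ S)`
    rw [hS]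
    have hui₀ : u i₀ ∈ Ideal.span (w '' S) := by
      have : u i₀ ∈ Ideal.span (w '' ↑l.support) := hwS.symm ▸ Ideal.subset_span ⟨i₀, hi₀, rfl⟩
      exact Ideal.span_mono (Set.image_mono hlS) this
    apply le_antisymm
    · rw [Ideal.span_le]
      rintro _ ⟨i, hi, rfl⟩
      by_cases hii : i = i₀
      · subst hii; exact hui₀
      · rw [← hwne hii]; exact Ideal.subset_span ⟨i, hi, rfl⟩
    · rw [Ideal.span_le]
      rintro _ ⟨i, hi, rfl⟩
      by_cases hii : i = i₀
      · subst hii; rw [hwi₀]; exact hhC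
      · rw [hwne hii]; exact Ideal.subset_span ⟨i, hi, rfl⟩

/-- [OURS · L1 W5.2 · T5-E (L-C)] The same with the host clause read as «`𝓗_x = (h)` with `h ∈ C_x`» (the output
shape of res-D-pv-054's regular-host lemma `not_stalkIdeal_le_sq_of_isPermissible`, p510520).
[cite: Kollar2007, 3.104 Step 2.1] -/
theorem cons_of_span_singleton_mem (hℬ : SNCWithAt ℬ C x) (h𝓗 : SNCWithAt (𝓗 :: 𝒦) ⊤ x)
    {h : X.presheaf.stalk x} (h𝓗x : stalkIdeal 𝓗 x = Ideal.span {h}) (hhC : h ∈ stalkIdeal C x)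
    (h𝒦' : ∀ B ∈ 𝒦', x ∈ B.support → B ∈ ℬ ∧ (B ∈ 𝒦 ∨ ¬ stalkIdeal B x ≤ stalkIdeal C x)) :
    SNCWithAt (𝓗 :: 𝒦') C x :=
  cons_of_stalkIdeal_le hℬ h𝓗 (by rw [h𝓗x, Ideal.span_singleton_le_iff_mem]; exact hhC) h𝒦'

/-- [OURS · L1 W5.2 · T5-E (L-C)] **COMBINATION form**: with `ℬ` snc with `C` at `x`, `𝓗 :: 𝒦` snc at `x`
(`𝒦`'s members through `x` in `ℬ`) and `𝓗_x ⊆ C_x`, the family `𝓗 :: (𝒦 ++ T)` is snc WITH `C` at `x` for any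
list `T` of members of `ℬ` that are transversal to the centre at `x` (`B_x ⊄ C_x` for `B ∈ T` through `x`).
[cite: Kollar2007, 3.104 Step 2.1] [cite: BierstoneGrigorievMilmanWlodarczyk2011, Def. 3.1.3 (2)] -/
theorem cons_transversal (hℬ : SNCWithAt ℬ C x) (h𝓗 : SNCWithAt (𝓗 :: 𝒦) ⊤ x)
    (h𝒦 : ∀ K ∈ 𝒦, x ∈ K.support → K ∈ ℬ) (h𝓗C : stalkIdeal 𝓗 x ≤ stalkIdeal C x)
    {T : List X.IdealSheafData}
    (hT : ∀ B ∈ T, x ∈ B.support → B ∈ ℬ ∧ ¬ stalkIdeal B x ≤ stalkIdeal C x) :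
    SNCWithAt (𝓗 :: (𝒦 ++ T)) C x := by
  refine cons_of_stalkIdeal_le hℬ h𝓗 h𝓗C fun B hB hxB => ?_
  rcases List.mem_append.mp hB with h | h
  · exact ⟨h𝒦 B h hxB, Or.inl h⟩
  · exact ⟨(hT B h hxB).1, Or.inr (hT B h hxB).2⟩

/-- [OURS · L1 W5.2 · T5-E (L-C)] **SWAP form** (no tracked members): `ℬ` snc with `C` at `x` and a host with
`𝓗_x = (h)`, `h ∈ C_z ∖ 𝔪_x²` — read as «`[𝓗]` snc at `x`» — give `𝓗 :: T` snc with `C` at `x` for any list `T` of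
`ℬ`-members transversal to `C` at `x`. [cite: Kollar2007, 3.104 Step 2.1] -/
theorem host_cons_transversal (hℬ : SNCWithAt ℬ C x) (h𝓗 : SNCWithAt [𝓗] ⊤ x)
    (h𝓗C : stalkIdeal 𝓗 x ≤ stalkIdeal C x) {T : List X.IdealSheafData}
    (hT : ∀ B ∈ T, x ∈ B.support → B ∈ ℬ ∧ ¬ stalkIdeal B x ≤ stalkIdeal C x) :
    SNCWithAt (𝓗 :: T) C x := by
  simpa using cons_transversal (𝒦 := []) hℬ h𝓗 (fun K hK _ => by simp at hK) h𝓗C hT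

/-! ## rev 2 (append-only): the two constructors asked by res-D-pv-054 AS res-L1-w52-stub-6 (2026-08-27T08:11:54Z) -/

/-- [OURS · L1 W5.2 · T5-E (L-C)] **A host of order one is snc at the point**: if `𝒪_{X,x}` is regular and
`𝓗_x = (h)` with `h ∈ 𝔪_x ∖ 𝔪_x²`, then `[𝓗]` has simple normal crossings at `x` — `h` extends to a regular system
of parameters (Matsumura 14.2; tree `exists_rsop_apply_eq`). The shape produced at weight-one pieces by
res-D-pv-054's `not_stalkIdeal_le_sq_of_isPermissible` (p510520). [cite: Matsumura1987, Thm. 14.2] -/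
theorem singleton_of_span_singleton (hreg : IsRegularLocalRing (X.presheaf.stalk x)) {h : X.presheaf.stalk x}
    (h𝓗x : stalkIdeal 𝓗 x = Ideal.span {h}) (hh : h ∈ maximalIdeal (X.presheaf.stalk x))
    (hh2 : h ∉ maximalIdeal (X.presheaf.stalk x) ^ 2) : SNCWithAt [𝓗] ⊤ x := by
  classical
  haveI := hreg
  set d := (maximalIdeal (X.presheaf.stalk x)).spanFinrank with hd
  -- `d ≥ 1` since `h ≠ 0` lies in `𝔪_x`
  have hd0 : 0 < d := by
    by_contra h0
    have hd00 : (maximalIdeal (X.presheaf.stalk x)).spanFinrank = 0 := by omega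
    have hbot : maximalIdeal (X.presheaf.stalk x) = ⊥ :=
      Submodule.spanFinrank_eq_zero_iff_eq_bot (IsNoetherian.noetherian _) |>.mp hd00
    apply hh2
    rw [hbot] at hh
    rw [(Submodule.mem_bot _).mp hh]
    exact zero_mem _
  obtain ⟨z, hz, hzj⟩ := exists_rsop_apply_eq hd.symm hh hh2 ⟨0, hd0⟩
  refine ⟨hreg, d, z, hd.symm, hz, ⟨fun _ => ⟨0, hd0⟩, fun D₁ D₂ _ => ?_, fun D => ?_⟩, fun hx => ?_⟩
  · exact Subtype.ext ((List.mem_singleton.mp D₁.2.1).trans (List.mem_singleton.mp D₂.2.1).symm)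
  · rw [List.mem_singleton.mp D.2.1, h𝓗x, hzj]
  · rw [Scheme.IdealSheafData.support_top] at hx
    exact absurd hx id

/-- [OURS · L1 W5.2 · T5-E (L-C)] **Off the host nothing is asked of it**: at a point `x ∉ V(𝓗)`,
`SNCWithAt ℬ' C x` gives `SNCWithAt (𝓗 :: ℬ') C x`. [folklore] -/
theorem cons_of_not_mem_support {ℬ' : List X.IdealSheafData} (h : SNCWithAt ℬ' C x) (hx : x ∉ 𝓗.support) :
    SNCWithAt (𝓗 :: ℬ') C x := by
  refine h.anti fun D hD hxD => ?_
  rcases List.mem_cons.mp hD with e | e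
  · exact absurd (e ▸ hxD) hx
  · exact e

end SNCWithAt

end DepthSNC

end Summit.ResolutionOfSingularities.ResolutionOfSingularities.Theorems

end
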